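import Mathlib
import Summits.Ventures.PercRepro2.CoinTreeCore
import Summits.Ventures.PercRepro2.CoinOrTailKDefs
import Summits.Ventures.PercRepro2.CoinChainBlindDarc

/-!
# The pure chain with a head-blind non-entry marker: the §59.9 instance in the kernel
(blind cell PercRepro2, night-2 g20; NIGHT2-DARC.md §60)

Sixteen coins on `Fin 11` (s = 0, m₁ = 1, e₁ = 2, m₂ = 3, a' = 4, a = 5, h₁ = 6, h₂ = 7,
h₃ = 8, w = 9, t = 10): the out-tree core `s → m₁`, `s → e₁`, `s → m₂`; the OR-vertex `a'`
entered from the entries `e₁, m₂` by sure arcs; the free-arc vertex `a` entered from `a'` by one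
coin; the head `a → h₁ ← e₁`, `h₁ → t`, `a → h₂ ← m₂`, `h₂ → t`, `w → h₃ ← m₂`, `a → h₃`,
`h₃ → t` (a's and w's routes both merge with core routes — the shape of the open instance of
§59.9, seed 31 it 113).  The marker `m₁` is a NON-ENTRY with no out-arcs (head-blind); the
marker `m₂` is an entry.  Row 2′DARC at `a → w` for the markers `(m₁, m₂)` for EVERY
probability vector with the two entry arcs sure (`darc_blind_example`) — every other coin
arbitrary.
-/

namespace Summit.Ventures.PercRepro2.Coin

namespace ChainBlindExample

open Classical

/-- The sixteen coins of the example. -/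
def arcsB : Fin 16 → Finset (Fin 11 × Fin 11)
  | 0 => {(0, 1)}    -- s → m₁
  | 1 => {(0, 2)}    -- s → e₁
  | 2 => {(0, 3)}    -- s → m₂
  | 3 => {(2, 4)}    -- e₁ → a' (sure)
  | 4 => {(3, 4)}    -- m₂ → a' (sure)
  | 5 => {(4, 5)}    -- a' → a (the chain coin)
  | 6 => {(5, 6)}    -- a → h₁
  | 7 => {(2, 6)}    -- e₁ → h₁
  | 8 => {(6, 10)}   -- h₁ → t
  | 9 => {(5, 7)}    -- a → h₂
  | 10 => {(3, 7)}   -- m₂ → h₂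
  | 11 => {(7, 10)}  -- h₂ → t
  | 12 => {(9, 8)}   -- w → h₃
  | 13 => {(3, 8)}   -- m₂ → h₃
  | 14 => {(8, 10)}  -- h₃ → t
  | _ => {(5, 8)}    -- a → h₃

/-- The entry coins of `a'`. -/
def c'B : Fin 11 → Fin 16
  | 2 => 3
  | 3 => 4
  | _ => 0

/-- The entry coin of `a`. -/
def cB : Fin 11 → Fin 16
  | 4 => 5
  | _ => 0

/-- The tree coins. -/
def tcB : Fin 11 → Fin 16
  | 1 => 0
  | 2 => 1
  | 3 => 2
  | _ => 0

/-- The parent map (the root `s`). -/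
def parB : Fin 11 → Fin 11 := fun _ => 0

/-- The rank. -/
def rkB : Fin 11 → ℕ
  | 1 => 1
  | 2 => 1
  | 3 => 1
  | _ => 0

/-- Every coin is a single arc. -/
lemma sameEnds_b : SameEnds arcsB := by
  intro e xy hxy x'y' hx'y'
  fin_cases e <;> simp [arcsB] at hxy hx'y' <;> subst hxy <;> subst hx'y' <;>
    exact ⟨Or.inl rfl, Or.inr rfl⟩

set_option maxRecDepth 20000 in
/-- The out-tree core `{m₁, e₁, m₂}`. -/
lemma treeCore_b : TreeCore arcsB 0 {1, 2, 3} tcB parB rkB where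
  tree := by decide
  par_mem := by decide
  rank := by decide
  into_C := by decide
  into_s := by decide
  s_notin := by decide

set_option maxRecDepth 20000 in
/-- `a' = 4` is an OR-vertex of the core entered from `e₁, m₂`. -/
lemma orTailK'_b : OrTailK arcsB 0 {1, 2, 3} {2, 3} c'B 4 where
  ent_sub := by decide
  s_notin := by decide
  a_notin := by decide
  a_ne_s := by decide
  into_U := by decide
  into_s := by decide
  into_a := by decide
  arcs_c := by decide
  c_inj := by decide

set_option maxRecDepth 20000 in
/-- `a = 5` is an OR-vertex of `U ∪ {a'}` entered from `a'` alone. -/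
lemma orTailK_b : OrTailK arcsB 0 (insert 4 {1, 2, 3}) {4} cB 5 where
  ent_sub := by decide
  s_notin := by decide
  a_notin := by decide
  a_ne_s := by decide
  into_U := by decide
  into_s := by decide
  into_a := by decide
  arcs_c := by decide
  c_inj := by decide

set_option maxRecDepth 20000 in
/-- **Row 2′DARC at `a → w` for the markers `(m₁, m₂)` on the sixteen-coin instance of §59.9,
every probability vector with the two entry arcs sure** — the non-entry marker `m₁` is
head-blind, the entry marker `m₂` shares its routes with `a` and `w`. -/
theorem darc_blind_example {R : Type*} [Field R] [LinearOrder R] [IsStrictOrderedRing R]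
    (pr : Fin 16 → R) (hp : IsProbVec pr) (h3 : pr 3 = 1) (h4 : pr 4 = 1) :
    DARC pr arcsB 0 {10} 1 3 5 9 :=
  darc_of_pureChainTree_of_blind pr hp sameEnds_b orTailK'_b
    (by
      intro r hr
      simp only [Finset.mem_insert, Finset.mem_singleton] at hr
      rcases hr with rfl | rfl
      · exact h3
      · exact h4)
    orTailK_b treeCore_b (by decide) (by decide) (by decide) (by decide) (by decide) (by decide)
    (by decide)

end ChainBlindExample

end Summit.Ventures.PercRepro2.Coin
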